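import Literature.MathematicalPhysics.QuantumFieldTheory.Balaban1983to89.B11Eq90V0primeBond
import Literature.MathematicalPhysics.QuantumFieldTheory.Balaban1983to89.B9Eq39TwoBackgroundLetters
import Literature.MathematicalPhysics.QuantumFieldTheory.Balaban1983to89.B8SectDSource
import Literature.MathematicalPhysics.QuantumFieldTheory.Balaban1983to89.B16Txt357ThirdOrderNonAbelian

/-!
# `Balaban1983to89.B11Eq30V0pTwoBackgrounds` — T. Bałaban, *The variational problem and background fields in renormalization group method for lattice gauge theories*, Commun. Math. Phys. **102** (1985) 277–309 [Balaban1985Variational]: (30) p. 282 (`V₀(A, ∂p) = η⁻⁴ρ_p`), (34)–(35) p. 283 and (63) p. 287, with [Balaban1985BackgroundPropagators] (3.1)–(3.5) pp. 390–391 — `V₀(A, ∂p)` AT TWO BACKGROUNDS: the value modulus between two unit-ball backgrounds `U, U′` with `‖U_b − U′_b‖ ≤ δ`, by a Cauchy estimate on the entire function of the four letters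

statement-level skeleton of published theorems with citation tags; proofs where landed; nothing here is a claim about the Yang–Mills mass gap

PDF held: `paper:balaban1985-cmp102-variational-background` (journal page = PDF page + 276), pp. 282, 284, 287, 291–292, through the verbatim
transcriptions of `B11Eq26ActionExpansion` ((30): `V0p`) and `B11Eq90V0primeBond` (`contDiff_rem_four`); `paper:balaban1985-cmp99-background-propagators`
pp. 390–391 through `B9Eq39Adjoint`
(`R`, `lettersA`, `plaqU`).

CITATION HEADER (lean-in-tree rule 2026-08-18).  WHAT IS REPRODUCED: nothing of print is asserted; print compares nothing between two backgrounds.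
Cell context (pub-balaban, NE9 chain): the W80 background-modulus line of this lineage (`B11Eq98W80BackgroundModulus.exists_W80_background_modulus`,
`B11Eq98W80ModulusLetterDefects.exists_W80_background_modulus_of_letter_defects`) leaves ONE letter modulus displayed, the V₀-group's `δ_V`:
`‖curV0 ρ τ U₁ Y − curV0 ρ τ U₂ (ιY)‖ ≤ δ_V` on a ball.  Since `B11Eq63V0GroupCurrent.curV0 = curV0prime + curComm` is, bond by bond, the sum of
the one-bond functionals (90) of `V′₀(·, ∂q)` and (92) of the (39)-term `½ i tr((DA)(q)Σ[A′,A′])`, i.e. (by (39) `V₀ = V′₀ + ½ i tr(…)`) the one-bond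
functional of the WHOLE `V₀(·, ∂q) = η⁻⁴ρ_q` ((30)), the modulus `δ_V` needs exactly two things, supplied here on [5]'s abstract lattice:
(a) a VALUE modulus of `V₀(A, ∂p)` between two backgrounds at a fixed COMPLEX configuration, (b) the induced OPERATOR-NORM modulus of the one-bond
functional by a Cauchy estimate on a circle in the bond variable's complex line ((63): «⟨(δ/δA′)D(A′), δA′⟩ = (d/dτ)D(A′ + τδA′)|_{τ=0}»).  THIS
file is (a); (b) and the carrier-level bond sums (the `δ_V` display itself) are the companion `B11Eq98V0CurrentBackgroundModulus`.

THE MECHANISM (print gives none; this file's).  `V₀(A, ∂p) = η⁻⁴·(−½)[τ(E(Y)·U(∂p)) + τ(U(∂p)⁻¹·E(Ỹ))]` with `E` the third-order exponential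
remainder (`B9Eq37Insertion.rem`) of the four scaled letters `Y = iη·(A′(b₁), …, A′(b₄))` of `∂p` ((34) p. 283; `B9Eq39Adjoint.lettersA`) — so it is
an ENTIRE function `Φ_W` of the four letters `v ∈ 𝔸⁴` (sup norm) at a fixed plaquette variable `W`, bounded by `|η|⁻⁴‖τ‖·expTail 3 (4|η|‖v‖)` for
`W, W⁻¹` in the unit ball (`B9Eq37Insertion.norm_rem_le`).  Two backgrounds change (i) the two transported letters `A′(b₁) = −R(U_ν(x))A_μ(x+e_ν)`,
`A′(b₄) = R(U_μ(x))A_ν(x+e_μ)` by at most `2δ·|A|` each (`B9Eq39TwoBackgroundLetters.norm_R_sub_R_le`) — absorbed by the Lipschitz constant of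
`Φ_W` on the sup-ball of radius `σ` obtained from the value bound on the ball `2σ` by Cauchy (`B8SectDSource.norm_fderiv_le_of_norm_le`) and the
mean-value inequality; (ii) the plaquette variable by at most `4δ` (`norm_plaqU_sub_plaqU_le`), and `W ↦ Φ_W(v)` is affine in `(W, W⁻¹)`.

WHAT IS PROVED (sorry-free; axioms `propext` / `Classical.choice` / `Quot.sound`; 0 def).
§1 **`size_lettersA_le_free`** (for unit-ball backgrounds the size `|A|(∂p)` is at most the BACKGROUND-FREE size
   `‖A_μ(x+e_ν)‖ + ‖A_ν(x)‖ + ‖A_μ(x)‖ + ‖A_ν(x+e_μ)‖`, so one size hypothesis serves both backgrounds; the unit-ball facts `‖R(V)X‖ ≤ ‖X‖`,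
   `‖U(∂p)^{±1}‖ ≤ 1` are `B16Txt357ThirdOrderNonAbelian.norm_R_le` / `norm_plaqU_le` BY NAME), `norm_plaqU_inv_sub_le` (`‖U(∂p)⁻¹ − U′(∂p)⁻¹‖ ≤ 4δ`).
§2 (the letter function, [folklore] calculus) `norm_sub_le_of_bound` (entire + bounded by `M` on the ball `R` ⇒ `M/(R − r)`-Lipschitz on the closed
   ball `r < R`), `differentiable_letterFun`, `norm_letterFun_le`, `norm_letterFun_sub_letterFun_le` (the `(W, W⁻¹)`-dependence).
§3 **`norm_V0p_sub_V0p_le`** — THE VALUE MODULUS: `‖V₀^{U}(A, ∂p) − V₀^{U′}(A, ∂p)‖ ≤ 6‖τ‖|η|⁻⁴·expTail 3 (8|η|σ)·δ` for unit-ball `U, U′` with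
   `‖U_b − U′_b‖ ≤ δ` and every complex configuration `A` of background-free size `≤ σ` at `∂p` (`0 < σ`).
(b) — the operator-norm modulus of the one-bond functional and the carrier-level `δ_V` display — is the companion
`B11Eq98V0CurrentBackgroundModulus` (§4–§5 there), which feeds §3 at size `2s` into a Cauchy estimate on the circle `|t| = s/(4‖X‖)`.

HONEST SCOPE — what is NOT claimed.  (i) CRUDE CONSTANTS: the background regularity (38) is not used and the (39) commutator term is not summed by
parts as in (91)–(96); consequently the moduli carry `|η|⁻⁴·expTail 3 (c|η|s) = O(|η|⁻¹s³)`, i.e. ONE inverse power of `η` against print's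
`η`-free (40)/(90)/(96) — a fixed-lattice reading, the generality of the cell's consumer (`Support/NE9CurChartLipschitzAtFlat`: fixed lattice,
finite-lattice constant), NOT print's uniformity.  (ii) Hypotheses: bond variables of both backgrounds in the unit balls of `𝔸` and `𝔸⁻¹`,
`‖U_b − U′_b‖ ≤ δ`, a continuous `τ` (no unitarity, no trace property, no (38) trace slots).  (iii) [5]'s abstract carrier (DIVERGENCE D-pv27.4
inherited); nothing of (40), (90), (96), Prop. 4 or any summit statement is asserted; NOT summit progress (cell pub-balaban: NE9 NOT PRINTED / NOT
PROVED; «NE9 ⇐ the named binders»; spine PROVED 0/9).  Unit `b2b-balaban-t4-ne9-formalise-leaf-05` (NE9 crux-team leaf prover, gen 71; the (w4) = δ_V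
line after `B9Eq39TwoBackgroundLetters`).  Imports `B11Eq90V0primeBond`, `B9Eq39TwoBackgroundLetters`, `B8SectDSource`, `B16Txt357ThirdOrderNonAbelian` (for `norm_R_le`,
`norm_plaqU_le`) ONLY; modifies nothing.
-/

noncomputable section

open NormedSpace Complex Metric Set Filter Topology

namespace Literature.MathematicalPhysics.QuantumFieldTheory.Balaban1983to89.B11Eq30V0pTwoBackgrounds

open Literature.MathematicalPhysics.QuantumFieldTheory.Balaban1983to89
open Literature.MathematicalPhysics.QuantumFieldTheory.Balaban1983to89.Beta.TransportVertices
open Literature.MathematicalPhysics.QuantumFieldTheory.Balaban1983to89.Beta.AdjointTransportJets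
open Literature.MathematicalPhysics.QuantumFieldTheory.Balaban1983to89.B9Eq37Insertion
open Literature.MathematicalPhysics.QuantumFieldTheory.Balaban1983to89.B9Eq39Adjoint
open Literature.MathematicalPhysics.QuantumFieldTheory.Balaban1983to89.B11Eq26ActionExpansion
open Literature.MathematicalPhysics.QuantumFieldTheory.Balaban1983to89.B11Eq90V0Derivative
open Literature.MathematicalPhysics.QuantumFieldTheory.Balaban1983to89.B11Eq90StB
open Literature.MathematicalPhysics.QuantumFieldTheory.Balaban1983to89.B11Eq90V0primeBond
open Literature.MathematicalPhysics.QuantumFieldTheory.Balaban1983to89.B9Eq39TwoBackgroundLetters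

variable {𝔸 : Type*} [NormedRing 𝔸] [NormedAlgebra ℂ 𝔸]

/-! ## §1 Unit-ball backgrounds: background-free sizes and the plaquette variable -/

section Sizes

variable {S : Type*} {ι : Type*} (T : ι → Equiv.Perm S) {U U' : ι → S → 𝔸ˣ} {δ : ℝ}

omit [NormedAlgebra ℂ 𝔸] in
/-- **THE SIZE `|A|(∂p)` IS AT MOST THE BACKGROUND-FREE SIZE** `‖A_μ(x+e_ν)‖ + ‖A_ν(x)‖ + ‖A_μ(x)‖ + ‖A_ν(x+e_μ)‖` for a background in the unit
balls — the two transported letters `A′(b₁) = −R(U_ν(x))A_μ(x+e_ν)`, `A′(b₄) = R(U_μ(x))A_ν(x+e_μ)` of (34) do not grow under `R`.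
[cite: Balaban1985Variational, (34) p.283, (25) p.282; Balaban1985BackgroundPropagators, (3.2) p.390] -/
theorem size_lettersA_le_free (hUn : ∀ μ x, ‖(U μ x : 𝔸)‖ ≤ 1 ∧ ‖(((U μ x)⁻¹ : 𝔸ˣ) : 𝔸)‖ ≤ 1) (A : ι → S → 𝔸) (μ ν : ι)
    (x : S) : size (lettersA T U A μ ν x) ≤ ‖A μ (T ν x)‖ + ‖A ν x‖ + ‖A μ x‖ + ‖A ν (T μ x)‖ := by
  rw [size_lettersA]
  have h1 := B16Txt357ThirdOrderNonAbelian.norm_R_le (hUn ν x) (A μ (T ν x))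
  have h4 := B16Txt357ThirdOrderNonAbelian.norm_R_le (hUn μ x) (A ν (T μ x))
  linarith

omit [NormedAlgebra ℂ 𝔸] in
/-- **The inverse plaquette variable at two backgrounds**: `‖U(∂p)⁻¹ − U′(∂p)⁻¹‖ ≤ 4δ` (`V⁻¹ − V′⁻¹ = V⁻¹(V′ − V)V′⁻¹` with
`B9Eq39TwoBackgroundLetters.norm_plaqU_sub_plaqU_le` and the unit balls). [cite: Balaban1985BackgroundPropagators, (3.1) p.390, (3.5) p.391] -/
theorem norm_plaqU_inv_sub_le (hUn : ∀ μ x, ‖(U μ x : 𝔸)‖ ≤ 1 ∧ ‖(((U μ x)⁻¹ : 𝔸ˣ) : 𝔸)‖ ≤ 1)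
    (hUn' : ∀ μ x, ‖(U' μ x : 𝔸)‖ ≤ 1 ∧ ‖(((U' μ x)⁻¹ : 𝔸ˣ) : 𝔸)‖ ≤ 1) (hUU' : ∀ μ x, ‖(U μ x : 𝔸) - (U' μ x : 𝔸)‖ ≤ δ)
    (μ ν : ι) (x : S) :
    ‖(((plaqU T U μ ν x)⁻¹ : 𝔸ˣ) : 𝔸) - (((plaqU T U' μ ν x)⁻¹ : 𝔸ˣ) : 𝔸)‖ ≤ 4 * δ := by
  have hδ0 : 0 ≤ δ := (norm_nonneg _).trans (hUU' μ x)
  refine (norm_units_inv_sub_inv_le _ _).trans ?_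
  calc _ ≤ 1 * (4 * δ) * 1 := by
        gcongr
        · exact (B16Txt357ThirdOrderNonAbelian.norm_plaqU_le T U hUn μ ν x).2
        · exact norm_plaqU_sub_plaqU_le T hUn hUn' hUU' μ ν x
        · exact (B16Txt357ThirdOrderNonAbelian.norm_plaqU_le T U' hUn' μ ν x).2
    _ = 4 * δ := by ring

end Sizes

/-! ## §2 `V₀(A, ∂p)` as an entire function of the four letters at a fixed plaquette variable -/

section LetterFunction

variable [CompleteSpace 𝔸]

omit [CompleteSpace 𝔸] in
/-- AN ENTIRE MAP BOUNDED BY `M` ON THE BALL OF RADIUS `R` IS `M/(R − r)`-LIPSCHITZ ON THE CLOSED BALL OF RADIUS `r < R` (Cauchy: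
`‖DΦ(z)‖ ≤ M/(R − ‖z‖)`, `B8SectDSource.norm_fderiv_le_of_norm_le`; then the mean-value inequality on the convex closed ball). [folklore]
[cite: Balaban1985Variational, (63) p.287] -/
theorem norm_sub_le_of_bound {E F : Type*} [NormedAddCommGroup E] [NormedSpace ℂ E] [NormedAddCommGroup F] [NormedSpace ℂ F]
    {Φ : E → F} (hΦ : Differentiable ℂ Φ) {R r M : ℝ} (hr : r < R) (hM : ∀ z : E, ‖z‖ < R → ‖Φ z‖ ≤ M)
    {v v' : E} (hv : ‖v‖ ≤ r) (hv' : ‖v'‖ ≤ r) : ‖Φ v - Φ v'‖ ≤ M / (R - r) * ‖v - v'‖ := by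
  have hR : 0 < R := lt_of_le_of_lt ((norm_nonneg v).trans hv) hr
  have hM0 : 0 ≤ M := (norm_nonneg _).trans (hM 0 (by simpa using hR))
  have hb : ∀ z ∈ closedBall (0 : E) r, ‖fderiv ℂ Φ z‖ ≤ M / (R - r) := by
    intro z hz
    rw [mem_closedBall_zero_iff] at hz
    have h := B8SectDSource.norm_fderiv_le_of_norm_le hΦ.differentiableOn
      (fun z' hz' => hM z' (mem_ball_zero_iff.1 hz')) (lt_of_le_of_lt hz hr)
    exact h.trans (div_le_div_of_nonneg_left hM0 (by linarith) (by linarith))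
  exact (convex_closedBall (0 : E) r).norm_image_sub_le_of_norm_fderiv_le (𝕜 := ℂ) (fun _ _ => hΦ.differentiableAt) hb
    (mem_closedBall_zero_iff.2 hv') (mem_closedBall_zero_iff.2 hv)

/-- The letter function `v ↦ η⁻⁴·(−½)[τ(E(iηv)·W) + τ(W⁻¹·E(invPath iηv))]` (= `V₀(A, ∂p)` at the letters `v = (A′(b₁), …, A′(b₄))`, (30) with
(34)–(35)) is entire on `𝔸⁴` («an analytic, and even an entire function of A», p. 282). [cite: Balaban1985Variational, (30) p.282, (34)-(35) p.283] -/
theorem differentiable_letterFun (η : ℝ) (τ : 𝔸 →L[ℂ] ℂ) (W : 𝔸ˣ) :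
    Differentiable ℂ (fun v : Fin 4 → 𝔸 => ((η : ℂ)⁻¹) ^ 4 * (-(2 : ℂ)⁻¹ *
      (τ (rem (letters η [v 0, v 1, v 2, v 3]) * (W : 𝔸))
        + τ (((W⁻¹ : 𝔸ˣ) : 𝔸) * rem (invPath (letters η [v 0, v 1, v 2, v 3])))))) := by
  simp only [letters, List.map_cons, List.map_nil, invPath_four]
  have h1 : ContDiff ℂ 1 (fun v : Fin 4 → 𝔸 =>
      rem [(I * ↑η) • v 0, (I * ↑η) • v 1, (I * ↑η) • v 2, (I * ↑η) • v 3]) := by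
    apply contDiff_rem_four <;> fun_prop
  have h2 : ContDiff ℂ 1 (fun v : Fin 4 → 𝔸 =>
      rem [-((I * ↑η) • v 3), -((I * ↑η) • v 2), -((I * ↑η) • v 1), -((I * ↑η) • v 0)]) := by
    apply contDiff_rem_four <;> fun_prop
  have hτ : Differentiable ℂ (fun X : 𝔸 => τ X) := τ.differentiable
  have h1' := h1.differentiable (by norm_num)
  have h2' := h2.differentiable (by norm_num)
  fun_prop

omit [NormedAlgebra ℂ 𝔸] [CompleteSpace 𝔸] in
/-- The size of the four scaled letters `iη·v` is `|η|(‖v₀‖ + ‖v₁‖ + ‖v₂‖ + ‖v₃‖) ≤ 4|η|‖v‖` (sup norm). [cite: Balaban1985Variational, (34) p.283] -/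
private theorem size_four (v : Fin 4 → 𝔸) : size [v 0, v 1, v 2, v 3] = ‖v 0‖ + ‖v 1‖ + ‖v 2‖ + ‖v 3‖ := by
  simp only [size_cons, size_nil]; ring

/-- **The value bound of the letter function**: `|Φ_W(v)| ≤ |η|⁻⁴·½‖τ‖(‖W‖ + ‖W⁻¹‖)·expTail 3 (|η|(‖v₀‖ + ‖v₁‖ + ‖v₂‖ + ‖v₃‖))` — the remainder is
third order (`B9Eq37Insertion.norm_rem_le`). [cite: Balaban1985Variational, (30)-(31) p.282, (35) p.283] -/
theorem norm_letterFun_le (η : ℝ) (τ : 𝔸 →L[ℂ] ℂ) (W : 𝔸ˣ) (v : Fin 4 → 𝔸) :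
    ‖((η : ℂ)⁻¹) ^ 4 * (-(2 : ℂ)⁻¹ * (τ (rem (letters η [v 0, v 1, v 2, v 3]) * (W : 𝔸))
        + τ (((W⁻¹ : 𝔸ˣ) : 𝔸) * rem (invPath (letters η [v 0, v 1, v 2, v 3])))))‖
      ≤ (|η|⁻¹) ^ 4 * (2⁻¹ * ‖τ‖ * (‖(W : 𝔸)‖ + ‖((W⁻¹ : 𝔸ˣ) : 𝔸)‖)
          * expTail 3 (|η| * (‖v 0‖ + ‖v 1‖ + ‖v 2‖ + ‖v 3‖))) := by
  rw [norm_mul, neg_mul, norm_neg, norm_pow, norm_inv, Complex.norm_real, Real.norm_eq_abs]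
  refine mul_le_mul_of_nonneg_left ?_ (by positivity)
  have h := norm_rem_le τ (letters η [v 0, v 1, v 2, v 3]) W
  rwa [size_letters, size_four] at h

omit [CompleteSpace 𝔸] in
/-- **The `(W, W⁻¹)`-dependence of the letter function is affine**: `|Φ_W(v) − Φ_{W′}(v)| ≤ |η|⁻⁴·½‖τ‖(‖W − W′‖ + ‖W⁻¹ − W′⁻¹‖)·expTail 3 (|η|Σ‖v_k‖)`.
[cite: Balaban1985Variational, (30) p.282, (35) p.283] -/
theorem norm_letterFun_sub_letterFun_le [CompleteSpace 𝔸] (η : ℝ) (τ : 𝔸 →L[ℂ] ℂ) (W W' : 𝔸ˣ) (v : Fin 4 → 𝔸) :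
    ‖((η : ℂ)⁻¹) ^ 4 * (-(2 : ℂ)⁻¹ * (τ (rem (letters η [v 0, v 1, v 2, v 3]) * (W : 𝔸))
        + τ (((W⁻¹ : 𝔸ˣ) : 𝔸) * rem (invPath (letters η [v 0, v 1, v 2, v 3])))))
      - ((η : ℂ)⁻¹) ^ 4 * (-(2 : ℂ)⁻¹ * (τ (rem (letters η [v 0, v 1, v 2, v 3]) * (W' : 𝔸))
        + τ (((W'⁻¹ : 𝔸ˣ) : 𝔸) * rem (invPath (letters η [v 0, v 1, v 2, v 3])))))‖
      ≤ (|η|⁻¹) ^ 4 * (2⁻¹ * ‖τ‖ * (‖(W : 𝔸) - (W' : 𝔸)‖ + ‖((W⁻¹ : 𝔸ˣ) : 𝔸) - ((W'⁻¹ : 𝔸ˣ) : 𝔸)‖)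
          * expTail 3 (|η| * (‖v 0‖ + ‖v 1‖ + ‖v 2‖ + ‖v 3‖))) := by
  set l := letters η [v 0, v 1, v 2, v 3] with hl
  have hsz : size l = |η| * (‖v 0‖ + ‖v 1‖ + ‖v 2‖ + ‖v 3‖) := by rw [hl, size_letters, size_four]
  have hE := norm_rem_le_expTail l
  have hE' := norm_rem_invPath_le_expTail l
  rw [hsz] at hE hE'
  have ht : 0 ≤ expTail 3 (|η| * (‖v 0‖ + ‖v 1‖ + ‖v 2‖ + ‖v 3‖)) := expTail_nonneg 3 (by positivity)
  have e : ((η : ℂ)⁻¹) ^ 4 * (-(2 : ℂ)⁻¹ * (τ (rem l * (W : 𝔸)) + τ (((W⁻¹ : 𝔸ˣ) : 𝔸) * rem (invPath l))))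
      - ((η : ℂ)⁻¹) ^ 4 * (-(2 : ℂ)⁻¹ * (τ (rem l * (W' : 𝔸)) + τ (((W'⁻¹ : 𝔸ˣ) : 𝔸) * rem (invPath l))))
      = ((η : ℂ)⁻¹) ^ 4 * (-(2 : ℂ)⁻¹ * (τ (rem l * ((W : 𝔸) - (W' : 𝔸)))
          + τ ((((W⁻¹ : 𝔸ˣ) : 𝔸) - ((W'⁻¹ : 𝔸ˣ) : 𝔸)) * rem (invPath l)))) := by
    rw [mul_sub, sub_mul, map_sub, map_sub]; ring
  rw [e, norm_mul, neg_mul, norm_neg, norm_pow, norm_inv, Complex.norm_real, Real.norm_eq_abs]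
  refine mul_le_mul_of_nonneg_left ?_ (by positivity)
  have h1 : ‖τ (rem l * ((W : 𝔸) - (W' : 𝔸)))‖ ≤ ‖τ‖ * (expTail 3 (|η| * (‖v 0‖ + ‖v 1‖ + ‖v 2‖ + ‖v 3‖)) * ‖(W : 𝔸) - (W' : 𝔸)‖) :=
    (τ.le_opNorm _).trans (mul_le_mul_of_nonneg_left ((norm_mul_le _ _).trans
      (mul_le_mul_of_nonneg_right hE (norm_nonneg _))) (norm_nonneg _))
  have h2 : ‖τ ((((W⁻¹ : 𝔸ˣ) : 𝔸) - ((W'⁻¹ : 𝔸ˣ) : 𝔸)) * rem (invPath l))‖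
      ≤ ‖τ‖ * (‖((W⁻¹ : 𝔸ˣ) : 𝔸) - ((W'⁻¹ : 𝔸ˣ) : 𝔸)‖ * expTail 3 (|η| * (‖v 0‖ + ‖v 1‖ + ‖v 2‖ + ‖v 3‖))) :=
    (τ.le_opNorm _).trans (mul_le_mul_of_nonneg_left ((norm_mul_le _ _).trans
      (mul_le_mul_of_nonneg_left hE' (norm_nonneg _))) (norm_nonneg _))
  calc _ ≤ ‖(2 : ℂ)⁻¹‖ * (‖τ (rem l * ((W : 𝔸) - (W' : 𝔸)))‖ + ‖τ ((((W⁻¹ : 𝔸ˣ) : 𝔸) - ((W'⁻¹ : 𝔸ˣ) : 𝔸)) * rem (invPath l))‖) := by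
        rw [norm_mul]; gcongr; exact norm_add_le _ _
    _ ≤ 2⁻¹ * (‖τ‖ * (expTail 3 (|η| * (‖v 0‖ + ‖v 1‖ + ‖v 2‖ + ‖v 3‖)) * ‖(W : 𝔸) - (W' : 𝔸)‖)
          + ‖τ‖ * (‖((W⁻¹ : 𝔸ˣ) : 𝔸) - ((W'⁻¹ : 𝔸ˣ) : 𝔸)‖ * expTail 3 (|η| * (‖v 0‖ + ‖v 1‖ + ‖v 2‖ + ‖v 3‖)))) := by
        rw [norm_inv, RCLike.norm_ofNat]; gcongr
    _ = _ := by ring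

end LetterFunction

/-! ## §3 The value modulus of `V₀(A, ∂p)` between two backgrounds -/

section Value

variable [CompleteSpace 𝔸] {S : Type*} {ι : Type*} (T : ι → Equiv.Perm S) {U U' : ι → S → 𝔸ˣ} {δ : ℝ}

/-- **`V₀(A, ∂p)` AT TWO BACKGROUNDS — THE VALUE MODULUS**: for bond variables of `U`, `U′` in the unit balls with `‖U_b − U′_b‖ ≤ δ` and a complex
configuration `A` of background-free size `‖A_μ(x+e_ν)‖ + ‖A_ν(x)‖ + ‖A_μ(x)‖ + ‖A_ν(x+e_μ)‖ ≤ σ` (`0 < σ`) at `∂p`,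
`‖V₀^{U}(A, ∂p) − V₀^{U′}(A, ∂p)‖ ≤ 6‖τ‖|η|⁻⁴·expTail 3 (8|η|σ)·δ` — the letters' change (`2δσ` in the sup norm, `norm_R_sub_R_le`) against the
Lipschitz constant `|η|⁻⁴‖τ‖expTail 3 (8|η|σ)/σ` of the letter function on the closed sup-ball `σ` (Cauchy from the ball `2σ`), plus the affine
`(U(∂p), U(∂p)⁻¹)`-dependence (`4δ + 4δ`). [cite: Balaban1985Variational, (30) p.282, (34)-(35) p.283; Balaban1985BackgroundPropagators, (3.1)-(3.5) pp.390-391] -/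
theorem norm_V0p_sub_V0p_le (hUn : ∀ μ x, ‖(U μ x : 𝔸)‖ ≤ 1 ∧ ‖(((U μ x)⁻¹ : 𝔸ˣ) : 𝔸)‖ ≤ 1)
    (hUn' : ∀ μ x, ‖(U' μ x : 𝔸)‖ ≤ 1 ∧ ‖(((U' μ x)⁻¹ : 𝔸ˣ) : 𝔸)‖ ≤ 1) (hUU' : ∀ μ x, ‖(U μ x : 𝔸) - (U' μ x : 𝔸)‖ ≤ δ)
    (η : ℝ) (τ : 𝔸 →L[ℂ] ℂ) (A : ι → S → 𝔸) (μ ν : ι) (x : S) {σ : ℝ} (hσ0 : 0 < σ)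
    (hσ : ‖A μ (T ν x)‖ + ‖A ν x‖ + ‖A μ x‖ + ‖A ν (T μ x)‖ ≤ σ) :
    ‖V0p T U η (τ : 𝔸 →ₗ[ℂ] ℂ) A μ ν x - V0p T U' η (τ : 𝔸 →ₗ[ℂ] ℂ) A μ ν x‖
      ≤ 6 * ‖τ‖ * (|η|⁻¹) ^ 4 * expTail 3 (8 * |η| * σ) * δ := by
  have hδ0 : 0 ≤ δ := (norm_nonneg _).trans (hUU' μ x)
  have n1 : 0 ≤ ‖A μ (T ν x)‖ := norm_nonneg _
  have n2 : 0 ≤ ‖A ν x‖ := norm_nonneg _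
  have n3 : 0 ≤ ‖A μ x‖ := norm_nonneg _
  have n4 : 0 ≤ ‖A ν (T μ x)‖ := norm_nonneg _
  -- the letter function at a plaquette variable `W₀`, and the two letter vectors
  set Φ : 𝔸ˣ → (Fin 4 → 𝔸) → ℂ := fun W₀ v => ((η : ℂ)⁻¹) ^ 4 * (-(2 : ℂ)⁻¹ *
      (τ (rem (letters η [v 0, v 1, v 2, v 3]) * (W₀ : 𝔸))
        + τ (((W₀⁻¹ : 𝔸ˣ) : 𝔸) * rem (invPath (letters η [v 0, v 1, v 2, v 3]))))) with hΦ
  set W := plaqU T U μ ν x with hW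
  set W' := plaqU T U' μ ν x with hW'
  set vU : Fin 4 → 𝔸 := ![-(R (U ν x) (A μ (T ν x))), -(A ν x), A μ x, R (U μ x) (A ν (T μ x))] with hvU
  set vU' : Fin 4 → 𝔸 := ![-(R (U' ν x) (A μ (T ν x))), -(A ν x), A μ x, R (U' μ x) (A ν (T μ x))] with hvU'
  have e1 : V0p T U η (τ : 𝔸 →ₗ[ℂ] ℂ) A μ ν x = Φ W vU := rfl
  have e2 : V0p T U' η (τ : 𝔸 →ₗ[ℂ] ℂ) A μ ν x = Φ W' vU' := rfl
  rw [e1, e2]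
  -- sizes of the letter vectors
  have hR1 := B16Txt357ThirdOrderNonAbelian.norm_R_le (hUn ν x) (A μ (T ν x))
  have hR4 := B16Txt357ThirdOrderNonAbelian.norm_R_le (hUn μ x) (A ν (T μ x))
  have hR1' := B16Txt357ThirdOrderNonAbelian.norm_R_le (hUn' ν x) (A μ (T ν x))
  have hR4' := B16Txt357ThirdOrderNonAbelian.norm_R_le (hUn' μ x) (A ν (T μ x))
  have hv : ‖vU‖ ≤ σ := by
    refine (pi_norm_le_iff_of_nonneg hσ0.le).2 ?_
    simp only [hvU, Fin.forall_fin_succ, Matrix.cons_val_zero, Matrix.cons_val_succ, norm_neg, IsEmpty.forall_iff, and_true]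
    exact ⟨by linarith, by linarith, by linarith, by linarith⟩
  have hv' : ‖vU'‖ ≤ σ := by
    refine (pi_norm_le_iff_of_nonneg hσ0.le).2 ?_
    simp only [hvU', Fin.forall_fin_succ, Matrix.cons_val_zero, Matrix.cons_val_succ, norm_neg, IsEmpty.forall_iff, and_true]
    exact ⟨by linarith, by linarith, by linarith, by linarith⟩
  have hsum' : ‖vU' 0‖ + ‖vU' 1‖ + ‖vU' 2‖ + ‖vU' 3‖ ≤ σ := by
    show ‖-(R (U' ν x) (A μ (T ν x)))‖ + ‖-(A ν x)‖ + ‖A μ x‖ + ‖R (U' μ x) (A ν (T μ x))‖ ≤ σ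
    rw [norm_neg, norm_neg]
    linarith
  have hdv : ‖vU - vU'‖ ≤ 2 * δ * σ := by
    refine (pi_norm_le_iff_of_nonneg (by positivity)).2 ?_
    simp only [hvU, hvU', Pi.sub_apply, Fin.forall_fin_succ, Matrix.cons_val_zero, Matrix.cons_val_succ, neg_sub_neg, sub_self,
      norm_zero, IsEmpty.forall_iff, and_true]
    refine ⟨?_, by positivity, by positivity, ?_⟩
    · rw [norm_sub_rev]
      exact (norm_R_sub_R_le (hUn ν x) (hUn' ν x) (hUU' ν x) _).trans (mul_le_mul_of_nonneg_left (by linarith) (by positivity))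
    · exact (norm_R_sub_R_le (hUn μ x) (hUn' μ x) (hUU' μ x) _).trans (mul_le_mul_of_nonneg_left (by linarith) (by positivity))
  -- the letter function at `W`: entire, bounded on the sup-ball `2σ`
  have hWn : ‖(W : 𝔸)‖ ≤ 1 := (B16Txt357ThirdOrderNonAbelian.norm_plaqU_le T U hUn μ ν x).1
  have hWi : ‖((W⁻¹ : 𝔸ˣ) : 𝔸)‖ ≤ 1 := (B16Txt357ThirdOrderNonAbelian.norm_plaqU_le T U hUn μ ν x).2
  have hE0 : 0 ≤ expTail 3 (8 * |η| * σ) := expTail_nonneg 3 (by positivity)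
  have hM : ∀ z : Fin 4 → 𝔸, ‖z‖ < 2 * σ → ‖Φ W z‖ ≤ (|η|⁻¹) ^ 4 * (‖τ‖ * expTail 3 (8 * |η| * σ)) := by
    intro z hz
    refine (norm_letterFun_le η τ W z).trans (mul_le_mul_of_nonneg_left ?_ (by positivity))
    have hz' : |η| * (‖z 0‖ + ‖z 1‖ + ‖z 2‖ + ‖z 3‖) ≤ 8 * |η| * σ := by
      have h0 := norm_le_pi_norm z 0; have h1 := norm_le_pi_norm z 1
      have h2 := norm_le_pi_norm z 2; have h3 := norm_le_pi_norm z 3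
      have : ‖z 0‖ + ‖z 1‖ + ‖z 2‖ + ‖z 3‖ ≤ 8 * σ := by linarith
      calc |η| * (‖z 0‖ + ‖z 1‖ + ‖z 2‖ + ‖z 3‖) ≤ |η| * (8 * σ) := mul_le_mul_of_nonneg_left this (abs_nonneg η)
        _ = 8 * |η| * σ := by ring
    have hmono := expTail_mono 3 (by positivity) hz'
    calc 2⁻¹ * ‖τ‖ * (‖(W : 𝔸)‖ + ‖((W⁻¹ : 𝔸ˣ) : 𝔸)‖) * expTail 3 (|η| * (‖z 0‖ + ‖z 1‖ + ‖z 2‖ + ‖z 3‖))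
        ≤ 2⁻¹ * ‖τ‖ * (1 + 1) * expTail 3 (8 * |η| * σ) := by
          gcongr
          exact expTail_nonneg 3 (by positivity)
      _ = ‖τ‖ * expTail 3 (8 * |η| * σ) := by ring
  -- (i) the letters: Lipschitz on the closed sup-ball `σ`
  have hlip := norm_sub_le_of_bound (differentiable_letterFun η τ W) (by linarith : σ < 2 * σ) hM hv hv'
  have hi : ‖Φ W vU - Φ W vU'‖ ≤ 2 * ‖τ‖ * (|η|⁻¹) ^ 4 * expTail 3 (8 * |η| * σ) * δ := by
    refine hlip.trans ?_
    have e : 2 * σ - σ = σ := by ring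
    rw [e]
    calc (|η|⁻¹) ^ 4 * (‖τ‖ * expTail 3 (8 * |η| * σ)) / σ * ‖vU - vU'‖
        ≤ (|η|⁻¹) ^ 4 * (‖τ‖ * expTail 3 (8 * |η| * σ)) / σ * (2 * δ * σ) :=
          mul_le_mul_of_nonneg_left hdv (by positivity)
      _ = 2 * ‖τ‖ * (|η|⁻¹) ^ 4 * expTail 3 (8 * |η| * σ) * δ := by field_simp
  -- (ii) the plaquette variable: affine dependence
  have hii : ‖Φ W vU' - Φ W' vU'‖ ≤ 4 * ‖τ‖ * (|η|⁻¹) ^ 4 * expTail 3 (8 * |η| * σ) * δ := by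
    refine (norm_letterFun_sub_letterFun_le η τ W W' vU').trans ?_
    have hdW : ‖(W : 𝔸) - (W' : 𝔸)‖ ≤ 4 * δ := norm_plaqU_sub_plaqU_le T hUn hUn' hUU' μ ν x
    have hdWi : ‖((W⁻¹ : 𝔸ˣ) : 𝔸) - ((W'⁻¹ : 𝔸ˣ) : 𝔸)‖ ≤ 4 * δ := norm_plaqU_inv_sub_le T hUn hUn' hUU' μ ν x
    have hmono : expTail 3 (|η| * (‖vU' 0‖ + ‖vU' 1‖ + ‖vU' 2‖ + ‖vU' 3‖)) ≤ expTail 3 (8 * |η| * σ) := by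
      refine expTail_mono 3 (by positivity) ?_
      calc |η| * (‖vU' 0‖ + ‖vU' 1‖ + ‖vU' 2‖ + ‖vU' 3‖) ≤ |η| * σ := mul_le_mul_of_nonneg_left hsum' (abs_nonneg η)
        _ ≤ 8 * |η| * σ := by nlinarith [abs_nonneg η]
    calc (|η|⁻¹) ^ 4 * (2⁻¹ * ‖τ‖ * (‖(W : 𝔸) - (W' : 𝔸)‖ + ‖((W⁻¹ : 𝔸ˣ) : 𝔸) - ((W'⁻¹ : 𝔸ˣ) : 𝔸)‖)
          * expTail 3 (|η| * (‖vU' 0‖ + ‖vU' 1‖ + ‖vU' 2‖ + ‖vU' 3‖)))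
        ≤ (|η|⁻¹) ^ 4 * (2⁻¹ * ‖τ‖ * (4 * δ + 4 * δ) * expTail 3 (8 * |η| * σ)) := by
          gcongr
          exact expTail_nonneg 3 (by positivity)
      _ = 4 * ‖τ‖ * (|η|⁻¹) ^ 4 * expTail 3 (8 * |η| * σ) * δ := by ring
  calc ‖Φ W vU - Φ W' vU'‖ = ‖(Φ W vU - Φ W vU') + (Φ W vU' - Φ W' vU')‖ := by rw [sub_add_sub_cancel]
    _ ≤ ‖Φ W vU - Φ W vU'‖ + ‖Φ W vU' - Φ W' vU'‖ := norm_add_le _ _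
    _ ≤ _ := by linarith

end Value

end Literature.MathematicalPhysics.QuantumFieldTheory.Balaban1983to89.B11Eq30V0pTwoBackgrounds

end
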